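import Summits.BirchSwinnertonDyer.BirchSwinnertonDyer.Theorems.GenusKolyvaginAtTwoEquivariantKolyvaginExactAtTwoSelmerDescentTwoTorsion
import Summits.BirchSwinnertonDyer.BirchSwinnertonDyer.Theorems.GenusKolyvaginAtTwoEquivariantKolyvaginExactAtTwoArchimedeanSelmerLevel
import HarnessLib

/-!
# Route `GenusKolyvaginAtTwo`, LINE 13, crux U `ShaCardDvdPowAtTwoR` (stmt-BirchSwinnertonDyer-28029):
# ONE-BIT DESCENT of the Selmer condition from a quadratic field — McCallum's Lemma 4.3 over `ℚ` for the
# DOUBLED descended classes, at EVERY place (transposition primes, `2`, bad places included)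

Seat `bsd-line-gk2-p3` g14 (cell `bsd-f1-sign2`), `--supports stmt-BirchSwinnertonDyer-28029` (helper; closes nothing).
THEOREMS ONLY (no definition, no named fact, no `sorry`); BSD is not proved by any of this.

The `ℚ`-pair frame of Kolyvagin's descent at `2` (`GenusExact.VisiblePairAtTwo.Input`) displays McCallum's Lemma 4.3 OVER `ℚ`
for the descended Kolyvagin classes `c₁(m) ∈ H¹(ℚ, E[2^M])`, `c₂(m) ∈ H¹(ℚ, E^{(d_K)}[2^M])` (fields `loc_c₁_fin`, `loc_c₂_fin`),
while what the theory supplies is Lemma 4.3 over the Heegner field `K` for `c_K(m) = res c₁(m)` resp. `hPsiKT (res c₂(m))`.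
This lineage transferred the condition `K → ℚ` EXACTLY at every place where that is possible (`…SelmerDescentQuadratic`,
`…SelmerDescentInert`, `…SelmerDescentTwoTorsion`: odd good places prime to `d_K`, `v = 2` inert, odd places without local
`2`-torsion); at a TRANSPOSITION prime `q ∣ d_K` (`#E(ℚ_q)[2] = 2`, always present on `Δ < 0`:
`…ShaCardDvdPowAtTwoRDefectPrimes`) the exact transfer fails by the local norm-index obstruction `H¹(K_w/ℚ_q, E(K_w)) ≅ ℤ/2`.
This file records the UNIFORM statement that survives everywhere: along an extension of degree `≤ 2` the Selmer condition
descends UP TO ONE BIT — if `res x` is Selmer at `w ∣ v` then `2x` is Selmer at `v` (corestriction ∘ restriction = 2 kills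
the obstruction; the tree's `SelmerDescent.two_nsmul_mem_localRestrictionKer_of_finrank_le_two`).  Consequences for the frame:
the displayed hypotheses `loc_c₁_fin` / `loc_c₂_fin` hold for `2 c₁(m)` / `2 c₂(m)` UNCONDITIONALLY from the `K`-statement,
at every finite place, any reduction, any level — i.e. the honest local condition at a transposition prime is the relaxed one
`{c : 2c ∈ Loc_v}`, one bit above `Loc_v`.

* §1 `two_zsmul_mem_selmerLocalKer_of_resTorsion_mem` — general: `[L : F] ≤ 2`, `w ∣ v` finite, any `n`, any reduction.
* §2 over `ℚ` with `K = ℚ(θ)` quadratic: member `E` (`two_zsmul_mem_selmerLocalKer_of_K`), twin member through `hPsiKT`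
  (`two_zsmul_mem_selmerLocalKer_twin_of_K`), and the global forms on `Δ(E) < 0` (infinite places free):
  `two_zsmul_mem_selmerGroup_of_resTorsion_mem`, `two_zsmul_mem_selmerGroup_twin_of_hPsiKT_resTorsion_mem` —
  **`res u ∈ Sel^{(n)}(E_K/K) ⟹ 2u ∈ Sel^{(n)}(E/ℚ)`**, **`hPsiKT (res y) ∈ Sel^{(n)}(E_K/K) ⟹ 2y ∈ Sel^{(n)}(E^{(c)}/ℚ)`**.

References: [McCallumLMS1991] §4 Lemma 4.3; [Kolyvagin1989Izv] §3; [SerreGaloisCohomology1997] I §2.4 (Cor. to Prop. 9);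
[Kramer1981] Prop. 3; [MazurRubin2010] Lemma 2.2 (i); [DokchitserDokchitserAnnals2010] Lemma 4.14 (proof).
-/

set_option autoImplicit false
set_option linter.dupNamespace false -- tree convention: `Summit.BirchSwinnertonDyer.BirchSwinnertonDyer.Theorems` (summit = sub-problem)

noncomputable section

open scoped Classical

universe u

namespace Summit.BirchSwinnertonDyer.BirchSwinnertonDyer.Theorems.GenusExact.SelmerDescent

open WeierstrassCurve NumberField IsDedekindDomain Field
open Literature.NumberTheory.EllipticCurves Literature.NumberTheory.GaloisRepresentations
open Summit.BirchSwinnertonDyer.BirchSwinnertonDyer.Theorems.GenusExact.ArchVanishing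
open Summit.BirchSwinnertonDyer.BirchSwinnertonDyer.Theorems.GenusExact.EigenClassesFinite

/-! ## §1 Degree `≤ 2`: the Selmer condition descends up to one bit at every finite place -/

section General

variable {F : Type u} [Field F] [NumberField F] (W : WeierstrassCurve F)
variable (L : Type u) [Field L] [NumberField L] [Algebra F L]
variable (v : HeightOneSpectrum (𝓞 F)) (w : HeightOneSpectrum (𝓞 L)) [w.asIdeal.LiesOver v.asIdeal]

/-- **One-bit descent of the Selmer condition along `[L : F] ≤ 2`.** For `E = W/F`, any `n : ℤ`, any finite place `v` of
`F` (any reduction, `v ∣ 2` allowed) and `w ∣ v`: if `res x ∈ H¹(L, E_L[n])` satisfies the Selmer condition at `w`, then `2x`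
satisfies the Selmer condition at `v`.  (The image of `x` in `H¹(F_v, E)` dies over `L_w`, and `[L_w : F_v] ≤ 2` kills
the kernel of restriction: `cor ∘ res`.) [cite: McCallumLMS1991, §4 Lemma 4.3] [cite: SerreGaloisCohomology1997, I §2.4 (Cor. to Prop. 9)] -/
theorem two_zsmul_mem_selmerLocalKer_of_resTorsion_mem (h2 : Module.finrank F L ≤ 2) (n : ℤ) {x : galH1Torsion W n}
    (hx : resTorsion W L n x ∈ selmerLocalKer (W.baseChange L) (w.adicCompletion L) n) :
    (2 : ℤ) • x ∈ selmerLocalKer W (v.adicCompletion F) n := by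
  letI : Algebra (v.adicCompletion F) (w.adicCompletion L) := (adicCompletionMap (K := F) L v w).toAlgebra
  haveI : IsScalarTower F (v.adicCompletion F) (w.adicCompletion L) :=
    IsScalarTower.of_algebraMap_eq fun x ↦ (adicCompletionMap_coe (K := F) L v w x).symm
  rw [mem_selmerLocalKer_iff_torsionH1ToH1_mem, map_zsmul, two_zsmul, ← two_nsmul]
  rw [mem_selmerLocalKer_iff_torsionH1ToH1_mem, torsionH1ToH1_resTorsion] at hx
  have hx' : torsionH1ToH1 W n x ∈ W.localRestrictionKer (w.adicCompletion L) :=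
    (mem_localRestrictionKer_iff_resBaseChange_mem W _).mpr hx
  exact two_nsmul_mem_localRestrictionKer_of_finrank_le_two W L v w h2 hx'

end General

/-! ## §2 Over `ℚ` with `K` quadratic: both members of the pair, local and global -/

section Rat

variable {K : Type} [Field K] [NumberField K] (W : WeierstrassCurve ℚ)

/-- **Member `E`, one finite place**: for `u ∈ H¹(ℚ, E[n])` with `res u = c_K` Selmer at the places of `K` above `v`,
`2u` is Selmer at `v` (any `v`, any reduction, any `n`). [cite: McCallumLMS1991, §4 Lemma 4.3] [cite: Kolyvagin1989Izv, §3] -/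
theorem two_zsmul_mem_selmerLocalKer_of_K (h2 : Module.finrank ℚ K = 2) (n : ℤ) {u : galH1Torsion W n}
    {cK : galH1Torsion (W.baseChange K) n} (hu : resTorsion W K n u = cK) (v : HeightOneSpectrum (𝓞 ℚ))
    (hK : ∀ (w : HeightOneSpectrum (𝓞 K)) [w.asIdeal.LiesOver v.asIdeal],
      cK ∈ selmerLocalKer (W.baseChange K) (w.adicCompletion K) n) :
    (2 : ℤ) • u ∈ selmerLocalKer W (v.adicCompletion ℚ) n := by
  obtain ⟨w, hw⟩ := exists_liesOver K v
  exact two_zsmul_mem_selmerLocalKer_of_resTorsion_mem W K v w h2.le n (hu ▸ hK w)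

/-- **Twin member `E^{(c)}`, one finite place** (`K = ℚ(θ)`, `θ² = c`): for `y ∈ H¹(ℚ, E^{(c)}[n])` with
`hPsiKT (res y) = c_K` Selmer at the places of `K` above `v`, `2y` is Selmer at `v` (any `v` — in particular `v ∣ c`, where the
twist is ADDITIVE —, any `n`). [cite: McCallumLMS1991, §4 Lemma 4.3] [cite: SilvermanAEC2009, X.5 Cor. 5.4] [cite: Kolyvagin1989Izv, §3] -/
theorem two_zsmul_mem_selmerLocalKer_twin_of_K (h2 : Module.finrank ℚ K = 2) {θ : K} {c : ℚ}
    (hθ : θ ∉ Set.range (algebraMap ℚ K)) (hc : θ ^ 2 = algebraMap ℚ K c) (n : ℤ)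
    {y : galH1Torsion (W.quadraticTwist c) n} {cK : galH1Torsion (W.baseChange K) n}
    (hy : hPsiKT W K hθ hc n (resTorsion (W.quadraticTwist c) K n y) = cK) (v : HeightOneSpectrum (𝓞 ℚ))
    (hK : ∀ (w : HeightOneSpectrum (𝓞 K)) [w.asIdeal.LiesOver v.asIdeal],
      cK ∈ selmerLocalKer (W.baseChange K) (w.adicCompletion K) n) :
    (2 : ℤ) • y ∈ selmerLocalKer (W.quadraticTwist c) (v.adicCompletion ℚ) n := by
  obtain ⟨w, hw⟩ := exists_liesOver K v
  have hx : resTorsion (W.quadraticTwist c) K n y ∈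
      selmerLocalKer ((W.quadraticTwist c).baseChange K) (w.adicCompletion K) n := by
    rw [mem_selmerLocalKer_iff_hPsiKT_mem W K hθ hc n (w.adicCompletion K), hy]
    exact hK w
  exact two_zsmul_mem_selmerLocalKer_of_resTorsion_mem (W.quadraticTwist c) K v w h2.le n hx

/-- **Member `E`, global, on `Δ(E) < 0`**: `res u ∈ Sel^{(n)}(E_K/K) ⟹ 2u ∈ Sel^{(n)}(E/ℚ)` (finite places by §1, infinite places
carry no condition on `Δ < 0`, `ArchVanishing.mem_selmerLocalKer_infinitePlace_of_Δ_neg`).  The descent `Sel(E_K)^{σ₀=+} → Sel(E/ℚ)`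
of LINE 6 is EXACT up to ONE BIT with no DEF-freeness hypothesis. [cite: McCallumLMS1991, §4 Lemma 4.3] [cite: Kolyvagin1989Izv, §3]
[cite: DokchitserDokchitserAnnals2010, Lemma 4.14 (proof)] -/
theorem two_zsmul_mem_selmerGroup_of_resTorsion_mem [W.IsElliptic] (h2 : Module.finrank ℚ K = 2) (hΔ : W.Δ < 0)
    (n : ℤ) {u : galH1Torsion W n} (hu : resTorsion W K n u ∈ selmerGroup (W.baseChange K) n) :
    (2 : ℤ) • u ∈ selmerGroup W n := by
  rw [mem_selmerGroup_iff] at hu ⊢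
  refine ⟨fun v ↦ two_zsmul_mem_selmerLocalKer_of_K W h2 n rfl v (fun w _ ↦ hu.1 w), fun w ↦ ?_⟩
  exact mem_selmerLocalKer_infinitePlace_of_Δ_neg W w hΔ n _

/-- **Twin member, global, on `Δ(E) < 0`** (`c ≠ 0`): `hPsiKT (res y) ∈ Sel^{(n)}(E_K/K) ⟹ 2y ∈ Sel^{(n)}(E^{(c)}/ℚ)`.  The descent
`Sel(E_K)^{σ₀=−} → Sel(E^{(c)}/ℚ)` of LINE 6 is EXACT up to ONE BIT with no DEF-freeness hypothesis.
[cite: McCallumLMS1991, §4 Lemma 4.3] [cite: Kolyvagin1989Izv, §3] [cite: DokchitserDokchitserAnnals2010, Lemma 4.14 (proof)] -/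
theorem two_zsmul_mem_selmerGroup_twin_of_hPsiKT_resTorsion_mem [W.IsElliptic] (h2 : Module.finrank ℚ K = 2) {θ : K}
    {c : ℚ} (hθ : θ ∉ Set.range (algebraMap ℚ K)) (hc : θ ^ 2 = algebraMap ℚ K c) (hc0 : c ≠ 0) (hΔ : W.Δ < 0)
    (n : ℤ) {y : galH1Torsion (W.quadraticTwist c) n}
    (hy : hPsiKT W K hθ hc n (resTorsion (W.quadraticTwist c) K n y) ∈ selmerGroup (W.baseChange K) n) :
    (2 : ℤ) • y ∈ selmerGroup (W.quadraticTwist c) n := by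
  rw [mem_selmerGroup_iff] at hy
  rw [mem_selmerGroup_iff]
  refine ⟨fun v ↦ two_zsmul_mem_selmerLocalKer_twin_of_K W h2 hθ hc n rfl v (fun w _ ↦ hy.1 w), fun w ↦ ?_⟩
  exact mem_selmerLocalKer_infinitePlace_quadraticTwist_of_Δ_neg W w hΔ hc0 n _

end Rat

end Summit.BirchSwinnertonDyer.BirchSwinnertonDyer.Theorems.GenusExact.SelmerDescent

end
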